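import Summits.QuantumFields.BalabanUV.T4Continuum.Support.CauchySumSummableShift

/-!
# CauchySumPinnedConvolution — node U6's `Summable δ` from ANY nonnegative summable scale shift (no monotonicity)
(cell `pub-balaban`, T4-DAG row `T4-U6.R-QCALC2°`, ruling §8 Q43; a sibling of `Support/CauchySumSummableShift`)

HONEST FRAMING (cell `pub-balaban`, page 1).  Rung (B)+1 of the FINITE-VOLUME T⁴ programme — NOT infinite volume, NOT a
mass gap, NOT the Clay problem; spine PROVED 0∕9.  ELEMENTARY REAL ANALYSIS on the hypothesis shape
`T4CauchySum.delta E ρ inj K = E · Σ_{(j,n) ∈ antidiagonal K} inj K j · ρ^n` of node U6 (the Cauchy sum); it asserts NOTHING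
about Bałaban's renormalization-group objects and is NOT an estimate of any NE row.  HONEST DEPENDENCY: continuum YM on T⁴ ⇐
BetaPertH ∧ nine spine estimates (0/9 proved); BetaPertH ⇐ (D1) ∧ (D4) ∧ CAP+tail; G-an2-4 gates asym, D1 and NE2/3/4.

WHAT IS PROVED.  `CauchySumSummableShift.summable_delta_of_shift` (= the calc lane's `QCalc2Sketch.SummableDeltaOfSummableShift`,
unfolded) obtains `Summable (delta E ρ inj)` from an IR-pinned injection `0 ≤ inj K j ≤ Σ_{i ∈ [j,K)} shift i` and a
nonnegative, ANTITONE, summable shift, through the per-`K` tail bound `delta_le_tail` (split at `K∕2`).  Here the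
monotonicity is REMOVED for the socket need `Summable δ` (it remains necessary for the per-`K` tail bound itself):
* `sum_antidiagonal_pinned_le_conv`: exchanging the order of summation (no split),
  `Σ_{(j,n) ∈ antidiagonal K} inj K j ρ^n ≤ (1−ρ)⁻¹ · Σ_{(i,m) ∈ antidiagonal K} shift i ρ^m` — a pinned sum is dominated by the
  CONVOLUTION of the shift with the geometric sequence (`Σ_{j ≤ i} ρ^{K−j} ≤ ρ^{K−i}∕(1−ρ)`);
* `delta_le_conv`: `delta E ρ inj K ≤ (E∕(1−ρ)) · Σ_{i+m=K} shift i ρ^m`;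
* `summable_delta_of_pinned_summable`: **`Summable (delta E ρ inj)` for `0 ≤ E`, `0 ≤ ρ < 1`, ANY nonnegative summable
  shift and any injection pinned by it** (Cauchy product of two nonnegative summable sequences,
  `summable_sum_mul_antidiagonal_of_summable_mul`);
* `tsum_delta_le`: the closed-form bound on the SUM, `Σ_K δ_K ≤ E · (Σ_i shift i) ∕ (1−ρ)²`;
* junction `example : type_of% @summable_delta_of_shift` (the landed statement re-derived with its `Antitone` binder
  unused), and `cauchySum_of_pinned_summable`: node U6 assembled on this instance (the 4-conjunct conclusion of
  `T4CauchySum.cauchySum`, verbatim); `summable_delta_indicator_shift`: non-vacuity on the NON-monotone shift `𝟙_{3}`.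
LABEL OF RECORD (T4-DAG §8 Q43 (c), not re-litigated): an admissible instance of node U6's `Summable δ` under reading (α′)
(re-evaluation with a g-Lipschitz size bound: the pin's «transport factor ≤ 1» is a displayed hypothesis, never a fact);
NOT shown sufficient under the naive crossover reading (β).  Mathlib + `T4CauchySum` + `CauchySumSummableShift` only; no
importer changes; found during the XREAD of p235574 ∕ p235948 (GAPS § C-ne7bleaf07g16-1 INFO-3; INTENT `CLAIMS.log` l.21184).
-/

namespace Summit.QuantumFields.BalabanUV.T4Continuum.CauchySumPinnedConvolution

open Finset
open Literature.MathematicalPhysics.QuantumFieldTheory.Balaban1983to89.T4CauchySum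
open Summit.QuantumFields.BalabanUV.T4Continuum.CauchySumSummableShift

/-! ## §1 A pinned sum is dominated by the convolution `shift ⋆ ρ^•` -/

/-- Inner geometric factor of the exchange of summation: `Σ_{j ≤ i} ρ^{K−j} ≤ ρ^{K−i}∕(1−ρ)` for `i ≤ K`, `0 ≤ ρ < 1`.
[folklore] -/
theorem sum_pow_sub_le {ρ : ℝ} (hρ : 0 ≤ ρ) (hρ1 : ρ < 1) {K i : ℕ} (hi : i ≤ K) :
    ∑ j ∈ range (i + 1), ρ ^ (K - j) ≤ ρ ^ (K - i) / (1 - ρ) := by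
  have e : ∀ j ∈ range (i + 1), ρ ^ (K - j) = ρ ^ (K - i) * ρ ^ (i - j) := by
    intro j hj
    have hj' : j ≤ i := Nat.lt_succ_iff.mp (mem_range.mp hj)
    rw [← pow_add]
    congr 1
    omega
  rw [sum_congr rfl e, ← mul_sum]
  have hrefl : ∑ j ∈ range (i + 1), ρ ^ (i - j) = ∑ j ∈ range (i + 1), ρ ^ j := by
    have := Finset.sum_range_reflect (fun m => ρ ^ m) (i + 1)
    simpa using this
  have hgeo : ∑ j ∈ range (i + 1), ρ ^ (i - j) ≤ 1 / (1 - ρ) := by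
    rw [hrefl, Finset.range_eq_Ico]
    simpa using geom_sum_Ico_le_of_lt_one (m := 0) (n := i + 1) hρ hρ1
  calc ρ ^ (K - i) * ∑ j ∈ range (i + 1), ρ ^ (i - j) ≤ ρ ^ (K - i) * (1 / (1 - ρ)) :=
        mul_le_mul_of_nonneg_left hgeo (pow_nonneg hρ _)
    _ = ρ ^ (K - i) / (1 - ρ) := by ring

/-- **A pinned sum is dominated by a convolution** (exchange of the order of summation; NO monotonicity of the shift):
for a nonnegative shift and `0 ≤ inj K j ≤ Σ_{i ∈ [j,K)} shift i`,
`Σ_{(j,n) ∈ antidiagonal K} inj K j ρ^n ≤ (1−ρ)⁻¹ · Σ_{(i,m) ∈ antidiagonal K} shift i ρ^m`. [folklore] -/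
theorem sum_antidiagonal_pinned_le_conv {ρ : ℝ} {shift : ℕ → ℝ} {inj : ℕ → ℕ → ℝ} (hρ : 0 ≤ ρ)
    (hρ1 : ρ < 1) (h0 : ∀ k, 0 ≤ shift k)
    (hpin : ∀ K j : ℕ, j ≤ K → 0 ≤ inj K j ∧ inj K j ≤ ∑ i ∈ Ico j K, shift i) (K : ℕ) :
    ∑ p ∈ antidiagonal K, inj K p.1 * ρ ^ p.2
      ≤ (1 / (1 - ρ)) * ∑ p ∈ antidiagonal K, shift p.1 * ρ ^ p.2 := by
  have hρ1' : 0 < 1 - ρ := by linarith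
  calc ∑ p ∈ antidiagonal K, inj K p.1 * ρ ^ p.2
      ≤ ∑ p ∈ antidiagonal K, (∑ i ∈ Ico p.1 K, shift i) * ρ ^ p.2 := by
        refine sum_le_sum fun p hp => ?_
        have hj : p.1 ≤ K := by have := mem_antidiagonal.mp hp; omega
        exact mul_le_mul_of_nonneg_right (hpin K p.1 hj).2 (pow_nonneg hρ _)
    _ = ∑ j ∈ range (K + 1), (∑ i ∈ Ico j K, shift i) * ρ ^ (K - j) :=
        Nat.sum_antidiagonal_eq_sum_range_succ (fun j n => (∑ i ∈ Ico j K, shift i) * ρ ^ n) K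
    _ = ∑ j ∈ range (K + 1), ∑ i ∈ Ico j K, shift i * ρ ^ (K - j) := by
        refine sum_congr rfl fun j _ => ?_
        rw [sum_mul]
    _ = ∑ i ∈ range K, ∑ j ∈ range (i + 1), shift i * ρ ^ (K - j) := by
        refine sum_comm' fun j i => ?_
        simp only [mem_range, mem_Ico]
        omega
    _ = ∑ i ∈ range K, shift i * ∑ j ∈ range (i + 1), ρ ^ (K - j) := by
        refine sum_congr rfl fun i _ => ?_
        rw [mul_sum]
    _ ≤ ∑ i ∈ range K, shift i * (ρ ^ (K - i) / (1 - ρ)) := by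
        refine sum_le_sum fun i hi => ?_
        exact mul_le_mul_of_nonneg_left (sum_pow_sub_le hρ hρ1 (mem_range.mp hi).le) (h0 i)
    _ ≤ ∑ i ∈ range (K + 1), shift i * (ρ ^ (K - i) / (1 - ρ)) := by
        rw [Finset.sum_range_succ]
        have : 0 ≤ shift K * (ρ ^ (K - K) / (1 - ρ)) := mul_nonneg (h0 K) (by positivity)
        linarith
    _ = (1 / (1 - ρ)) * ∑ i ∈ range (K + 1), shift i * ρ ^ (K - i) := by
        rw [mul_sum]
        refine sum_congr rfl fun i _ => ?_
        ring
    _ = (1 / (1 - ρ)) * ∑ p ∈ antidiagonal K, shift p.1 * ρ ^ p.2 := by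
        rw [Nat.sum_antidiagonal_eq_sum_range_succ (fun i m => shift i * ρ ^ m) K]

/-- The transported total against the convolution: `delta E ρ inj K ≤ (E∕(1−ρ)) · Σ_{i+m=K} shift i ρ^m` (`0 ≤ E`).
[folklore] -/
theorem delta_le_conv {E ρ : ℝ} {shift : ℕ → ℝ} {inj : ℕ → ℕ → ℝ} (hE : 0 ≤ E) (hρ : 0 ≤ ρ) (hρ1 : ρ < 1)
    (h0 : ∀ k, 0 ≤ shift k) (hpin : ∀ K j : ℕ, j ≤ K → 0 ≤ inj K j ∧ inj K j ≤ ∑ i ∈ Ico j K, shift i)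
    (K : ℕ) : delta E ρ inj K ≤ (E / (1 - ρ)) * ∑ p ∈ antidiagonal K, shift p.1 * ρ ^ p.2 := by
  unfold delta
  have h := mul_le_mul_of_nonneg_left (sum_antidiagonal_pinned_le_conv hρ hρ1 h0 hpin K) hE
  calc E * ∑ p ∈ antidiagonal K, inj K p.1 * ρ ^ p.2
      ≤ E * ((1 / (1 - ρ)) * ∑ p ∈ antidiagonal K, shift p.1 * ρ ^ p.2) := h
    _ = (E / (1 - ρ)) * ∑ p ∈ antidiagonal K, shift p.1 * ρ ^ p.2 := by ring

/-! ## §2 Summability of `delta` for ANY nonnegative summable shift, and the bound on the sum -/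

/-- The convolution `K ↦ Σ_{i+m=K} shift i ρ^m` of a nonnegative summable shift with the geometric sequence `ρ^m`,
`0 ≤ ρ < 1`, is summable (Cauchy product of two nonnegative summable sequences). [folklore] -/
theorem summable_conv {ρ : ℝ} {shift : ℕ → ℝ} (hρ : 0 ≤ ρ) (hρ1 : ρ < 1) (h0 : ∀ k, 0 ≤ shift k)
    (hsum : Summable shift) : Summable (fun K : ℕ => ∑ p ∈ antidiagonal K, shift p.1 * ρ ^ p.2) :=
  summable_sum_mul_antidiagonal_of_summable_mul
    (hsum.mul_of_nonneg (summable_geometric_of_lt_one hρ hρ1) (fun k => h0 k) fun n => pow_nonneg hρ n)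

/-- **Σ_K δ_K < ∞ for ANY nonnegative summable shift** (no monotonicity, no geometric rate): `0 ≤ E`, `0 ≤ ρ < 1`,
`0 ≤ shift`, `Summable shift` and an injection pinned by the shift give `Summable (delta E ρ inj)`. [folklore] -/
theorem summable_delta_of_pinned_summable {E ρ : ℝ} {shift : ℕ → ℝ} {inj : ℕ → ℕ → ℝ} (hE : 0 ≤ E)
    (hρ : 0 ≤ ρ) (hρ1 : ρ < 1) (h0 : ∀ k, 0 ≤ shift k) (hsum : Summable shift)
    (hpin : ∀ K j : ℕ, j ≤ K → 0 ≤ inj K j ∧ inj K j ≤ ∑ i ∈ Ico j K, shift i) :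
    Summable (delta E ρ inj) :=
  Summable.of_nonneg_of_le (fun K => delta_nonneg_of_pinned hE hρ hpin K)
    (fun K => delta_le_conv hE hρ hρ1 h0 hpin K) ((summable_conv hρ hρ1 h0 hsum).mul_left _)

/-- **The bound on the sum**: `Σ_K δ_K ≤ E · (Σ_i shift i) ∕ (1−ρ)²` — the Cauchy product `(Σ shift)·(Σ ρ^m)` and
`Σ ρ^m = (1−ρ)⁻¹`. [folklore] -/
theorem tsum_delta_le {E ρ : ℝ} {shift : ℕ → ℝ} {inj : ℕ → ℕ → ℝ} (hE : 0 ≤ E) (hρ : 0 ≤ ρ) (hρ1 : ρ < 1)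
    (h0 : ∀ k, 0 ≤ shift k) (hsum : Summable shift)
    (hpin : ∀ K j : ℕ, j ≤ K → 0 ≤ inj K j ∧ inj K j ≤ ∑ i ∈ Ico j K, shift i) :
    ∑' K, delta E ρ inj K ≤ E * (∑' i, shift i) / (1 - ρ) ^ 2 := by
  have hconv := summable_conv hρ hρ1 h0 hsum
  have h1 : ∑' K, delta E ρ inj K ≤ ∑' K, (E / (1 - ρ)) * ∑ p ∈ antidiagonal K, shift p.1 * ρ ^ p.2 :=
    (summable_delta_of_pinned_summable hE hρ hρ1 h0 hsum hpin).tsum_le_tsum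
      (fun K => delta_le_conv hE hρ hρ1 h0 hpin K) (hconv.mul_left _)
  have hnorm_s : Summable fun i => ‖shift i‖ := by
    simpa [Real.norm_eq_abs, abs_of_nonneg (h0 _)] using hsum
  have hnorm_g : Summable fun n : ℕ => ‖ρ ^ n‖ := by
    simpa [Real.norm_eq_abs, abs_of_nonneg (pow_nonneg hρ _)] using summable_geometric_of_lt_one hρ hρ1
  have hprod : ∑' K, ∑ p ∈ antidiagonal K, shift p.1 * ρ ^ p.2 = (∑' i, shift i) * ∑' n : ℕ, ρ ^ n :=
    (tsum_mul_tsum_eq_tsum_sum_antidiagonal_of_summable_norm hnorm_s hnorm_g).symm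
  rw [tsum_mul_left, hprod, tsum_geometric_of_lt_one hρ hρ1] at h1
  have hρ1' : (1 - ρ) ≠ 0 := by linarith
  calc ∑' K, delta E ρ inj K ≤ E / (1 - ρ) * ((∑' i, shift i) * (1 - ρ)⁻¹) := h1
    _ = E * (∑' i, shift i) / (1 - ρ) ^ 2 := by field_simp

/-! ## §3 Junction with `CauchySumSummableShift` and node U6 assembled on this instance -/

/-- JUNCTION (an `example`, so that no duplicate of a landed statement is declared): the statement of
`CauchySumSummableShift.summable_delta_of_shift` (read off by `type_of%`), re-derived with its `Antitone shift` binder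
UNUSED. [folklore] -/
example : type_of% @summable_delta_of_shift :=
  fun hE hρ hρ1 h0 _ hsum hpin => summable_delta_of_pinned_summable hE hρ hρ1 h0 hsum hpin

/-- **Node U6 (THE CAUCHY SUM) on the pinned-by-a-summable-shift instance** — the sibling of `T4CauchySum.cauchySum` ∕
`CauchySumSummableShift.cauchySum_of_shift` with NEITHER a geometric `InjectedRate` NOR a monotone shift: `0 ≤ E`,
`0 ≤ ρ < 1`, a nonnegative summable shift pinning the injection, `0 ≤ l₀` and node U5 as `MatchingModConstants` give the
4-conjunct conclusion of `T4CauchySum.cauchySum` verbatim.  CONDITIONAL kernel theorem over hypothesis shapes; none of its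
hypotheses is in print for Bałaban's d = 4 procedure; admissible at node U6 under reading (α′) only (T4-DAG §8 Q43 (c)).
[folklore] -/
theorem cauchySum_of_pinned_summable {ρ E vol l₀ : ℝ} {shift : ℕ → ℝ} {inj : ℕ → ℕ → ℝ} {Z : ℕ → ℝ → ℝ}
    (hE : 0 ≤ E) (hρ : 0 ≤ ρ) (hρ1 : ρ < 1) (h0 : ∀ k, 0 ≤ shift k) (hsum : Summable shift)
    (hpin : ∀ K j : ℕ, j ≤ K → 0 ≤ inj K j ∧ inj K j ≤ ∑ i ∈ Ico j K, shift i)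
    (hl₀ : 0 ≤ l₀) (hU5 : MatchingModConstants vol l₀ (delta E ρ inj) Z) :
    Summable (delta E ρ inj) ∧
    (∀ K : ℕ, ∀ t : ℝ, |t| ≤ l₀ → |genFun Z (K + 1) t - genFun Z K t| ≤ 2 * (vol * delta E ρ inj K)) ∧
    (∀ t : ℝ, |t| ≤ l₀ → CauchySeq fun K => genFun Z K t) ∧
    TendstoUniformlyOn (fun K t => genFun Z K t) (genFunLim Z) Filter.atTop {t | |t| ≤ l₀} := by
  have hδ : Summable (delta E ρ inj) := summable_delta_of_pinned_summable hE hρ hρ1 h0 hsum hpin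
  exact ⟨hδ, fun K t ht => abs_genFun_succ_sub_le hU5 hl₀ K ht, fun t ht => cauchySeq_genFun hU5 hl₀ hδ ht,
    tendstoUniformlyOn_genFun hU5 hl₀ hδ⟩

/-- NON-VACUITY beyond monotone classes: the NON-monotone summable shift `𝟙_{3}` (for which the per-`K` tail bound of
`CauchySumSummableShift.delta_le_tail` FAILS at `E = 1`, `ρ = 1∕2`, `K = 4`) still gives `Summable δ` for every injection it
pins. [folklore] -/
theorem summable_delta_indicator_shift {E ρ : ℝ} {inj : ℕ → ℕ → ℝ} (hE : 0 ≤ E) (hρ : 0 ≤ ρ) (hρ1 : ρ < 1)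
    (hpin : ∀ K j : ℕ, j ≤ K → 0 ≤ inj K j ∧ inj K j ≤ ∑ i ∈ Ico j K, (if i = 3 then (1 : ℝ) else 0)) :
    Summable (delta E ρ inj) :=
  summable_delta_of_pinned_summable hE hρ hρ1 (fun k => by split_ifs <;> norm_num)
    (summable_of_ne_finset_zero (s := {3}) fun i hi => by
      have : i ≠ 3 := by simpa using hi
      simp [this]) hpin

end Summit.QuantumFields.BalabanUV.T4Continuum.CauchySumPinnedConvolution
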